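import Summits.QuantumFields.YangMills.Theorems.F4SubCurvatureDoorSubCurvatureKernelExplicitDensity
import Summits.QuantumFields.YangMills.Theorems.F4SubCurvatureDoorSubCurvatureKernelFaithfulness
import HarnessLib

/-!
# Route `F4SubCurvatureDoor`, crux `SubCurvatureClause` ⟨stmt-QuantumFields-23763⟩ — DENSITY TRANSFER tools (lattice collar ⇒ limit densities ⇒ pointwise kernel bounds)

Helper file (`--supports stmt-QuantumFields-23763 --as helper`; free-hands seat `ym-line-frs-p2` g19, step T3 «soft passage to the
limit kernel» of the director's TRANSFER brief R525a-ym / planner pre-brief `HOME g23/PREBRIEF-23763-transfer.md`).  Definition-free,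
0 sorry, standard axioms.  No item is closed; no summit, no crux and no mass gap is proved by this file.

WHAT.  `SubCurvatureClause` (route file `Theses/F4SubCurvatureDoor.lean` :374) asks, for every off-diagonal leg-scheme limit point `S₁`
and EVERY kernel `K` continuous off `0` representing `S₁ 2` on compactly supported off-diagonal test functions, that `‖x‖⁸ K(x) → 0` at
`x → 0`.  The two tools by which a LATTICE two-point collar bound reaches such a kernel:

* `abs_le_of_density_bound` (§1, kernel-generic): a kernel continuous off `0` representing a functional `S₂` on compactly supported
  off-diagonal test functions, with `‖S₂ F‖ ≤ B ∫‖F‖` whenever `tsupport F ⊆ Separated 2 δ`, satisfies `|K x| ≤ B` for `‖x‖ > δ`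
  (test functions `g(y₀ − y₁) χ(y₁)` with normed bumps, Fubini ✓`integral_fin_two_shear`, continuity at `x`);
* `norm_le_of_tendsto_latticeDist_of_collar` / `norm_two_le_of_offDiagLimitAlong_of_collar` (§2): a centred-density collar bound
  AT ONE ORDER `N` with constants `(C, β₄, ℓ₄)` (the order-`N` line of `MomentBounds`, any constants) passes to every sequential limit
  of the lattice distributions: `‖S₁ N F‖ ≤ (C (24/δ + 2/ℓ₄ + 24)⁴)ᴺ ∫‖F‖` on `Separated N δ` — the proof of
  ✓`norm_le_explicit_of_tendsto_latticeDist` re-run with the order-`N` hypothesis only; specialised to `N = 2` along leg schemes.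

Consumed by `Theorems/F4SubCurvatureDoorSubCurvatureClauseLatticeTransfer.lean` (the ε-form lattice sub-curvature collar ⇒ the clause).

HONEST LABEL: transfer tools; they prove NO asymptotic freedom; ⟨23763⟩, ⟨23036⟩ are open problems; the Yang–Mills mass gap is NOT
proved; no summit is proved by a line.
-/

set_option autoImplicit false

noncomputable section

open scoped SchwartzMap BigOperators ContDiff
open MeasureTheory Filter Topology Metric Set
open Literature.MathematicalPhysics.QuantumFieldTheory Literature.MathematicalPhysics.QuantumLattice
open Literature.MathematicalPhysics.AQFT
open Literature.Probability.LatticeModels (box Site mem_box)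
open Summit.QuantumFields.YangMills.Cruxes.OSLegsFromFemtoAndGap.DlrCollarTransfer (dens torusE)
open Summit.QuantumFields.YangMills.Cruxes.OSLegsAtWeakCouplingC.Sketch (Separated tendsto_riemann_sum)
open Summit.QuantumFields.YangMills.Theorems.OSLegsFromFemtoAndGap
open Summit.QuantumFields.YangMills.Theorems.ROT (IsLegScheme OffDiagLimitAlong)
open Summit.QuantumFields.YangMills.Theorems.NPointIsotropy.Negative (E4)
open Summit.QuantumFields.YangMills.Theorems.F4SubCurvatureDoorSubCurvatureKernelFaithful
  (integral_fin_two_shear continuous_mul_of_tsupport_subset)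

namespace Summit.QuantumFields.YangMills.Theorems.F4SubCurvatureDoorSubCurvatureClauseDensityTransfer

/-! ## §1 Pointwise kernel bounds from density bounds (kernel-generic) -/

/-- **Pointwise bound from a density bound.**  If `K` is continuous off `0` and represents `S₂` on compactly supported off-diagonal
test functions, and `‖S₂ F‖ ≤ B ∫‖F‖` for every compactly supported `F` with `tsupport F ⊆ Separated 2 δ` (`δ > 0`), then `|K x| ≤ B`
for every `‖x‖ > δ`.  Test functions `F(y) = g(y₀ − y₁) χ(y₁)`, `g` the normed bump of small radius at `x`, `χ` a normed bump:
`S₂ F = ∫ K g`, `∫‖F‖ = 1`, and `∫ K g → K x` by continuity. [folklore; Hörmander ALPDO I, Thm 1.2.5] -/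
theorem abs_le_of_density_bound (K : E4 → ℝ) (hKc : ContinuousOn K {x | x ≠ 0})
    (S₂ : 𝓢((Fin 2 → E4), ℂ) →L[ℂ] ℂ)
    (hrep : ∀ F : 𝓢((Fin 2 → E4), ℂ), IsOffDiagonal F → HasCompactSupport (F : (Fin 2 → E4) → ℂ) →
      Integrable (fun x : Fin 2 → E4 => (K (x 0 - x 1) : ℂ) * F x) ∧
        S₂ F = ∫ x : Fin 2 → E4, (K (x 0 - x 1) : ℂ) * F x)
    {δ B : ℝ} (hδ : 0 < δ)
    (hB : ∀ F : 𝓢((Fin 2 → E4), ℂ), HasCompactSupport (F : (Fin 2 → E4) → ℂ) →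
      tsupport (F : (Fin 2 → E4) → ℂ) ⊆ Separated 2 δ → ‖S₂ F‖ ≤ B * ∫ x, ‖F x‖) :
    ∀ x : E4, δ < ‖x‖ → |K x| ≤ B := by
  intro x₀ hx₀
  have hx₀ne : x₀ ≠ 0 := by
    intro h
    rw [h, norm_zero] at hx₀
    exact lt_irrefl _ (hδ.trans hx₀)
  refine le_of_forall_pos_le_add fun ε hε => ?_
  -- continuity of `K` at `x₀`: radius `η`
  have hKat : ContinuousAt K x₀ := hKc.continuousAt (isOpen_ne.mem_nhds hx₀ne)
  obtain ⟨η, hη, hKη⟩ := Metric.continuousAt_iff.1 hKat ε hε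
  -- the bump radius `η' < min η (‖x₀‖ − δ)`
  set η' : ℝ := min η (‖x₀‖ - δ) / 2 with hη'
  have hmin : 0 < min η (‖x₀‖ - δ) := lt_min hη (by linarith)
  have hη'0 : 0 < η' := by positivity
  have hη'η : η' < η := by
    have := min_le_left η (‖x₀‖ - δ)
    rw [hη']; linarith
  have hη'δ : η' < ‖x₀‖ - δ := by
    have := min_le_right η (‖x₀‖ - δ)
    rw [hη']; linarith
  -- the normed bump `g` at `x₀` of outer radius `η'`, and a normed bump `χ` at `0`
  let bg : ContDiffBump x₀ := ⟨η' / 2, η', by positivity, by linarith⟩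
  set g : E4 → ℝ := bg.normed volume with hg
  have hgs : ContDiff ℝ ∞ g := bg.contDiff_normed
  have hgc : HasCompactSupport g := bg.hasCompactSupport_normed
  have hg1 : ∫ x, g x = 1 := bg.integral_normed
  have hgi : Integrable g := bg.integrable_normed
  have hg0 : ∀ x, 0 ≤ g x := fun x => bg.nonneg_normed x
  have hgsupp : tsupport g ⊆ closedBall x₀ η' := by
    rw [hg, bg.tsupport_normed_eq]
  let b : ContDiffBump (0 : E4) := ⟨1, 2, one_pos, one_lt_two⟩
  set χ : E4 → ℝ := b.normed volume with hχ
  have hχs : ContDiff ℝ ∞ χ := b.contDiff_normed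
  have hχc : HasCompactSupport χ := b.hasCompactSupport_normed
  have hχ1 : ∫ x, χ x = 1 := b.integral_normed
  have hχi : Integrable χ := b.integrable_normed
  have hχ0 : ∀ x, 0 ≤ χ x := fun x => b.nonneg_normed x
  -- points of `tsupport g` are off `0`, at distance `> δ` from `0` and within `η` of `x₀`
  have hgU : tsupport g ⊆ {x | x ≠ 0} := by
    intro u hu h0
    have h1 : dist u x₀ ≤ η' := mem_closedBall.1 (hgsupp hu)
    rw [h0, dist_comm, dist_zero_right] at h1
    linarith [hδ]
  have hgδ : ∀ u ∈ tsupport g, δ < ‖u‖ := by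
    intro u hu
    have h1 : dist u x₀ ≤ η' := mem_closedBall.1 (hgsupp hu)
    have h2 : ‖x₀‖ - ‖u‖ ≤ ‖x₀ - u‖ := norm_sub_norm_le x₀ u
    rw [dist_eq_norm, ← norm_neg, neg_sub] at h1
    linarith
  have hgη : ∀ u ∈ tsupport g, dist (K u) (K x₀) < ε := fun u hu =>
    hKη ((mem_closedBall.1 (hgsupp hu)).trans_lt hη'η)
  -- the test function `f(y) = g(y₀ − y₁) χ(y₁)` and its Schwartz incarnation (pattern ✓`kernel_eq_of_apply_linActMulti_eq`)
  set f : (Fin 2 → E4) → ℂ := fun y => ((g (y 0 - y 1) * χ (y 1) : ℝ) : ℂ) with hf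
  have h0 : ContDiff ℝ ∞ (fun y : Fin 2 → E4 => y 0) := contDiff_apply ℝ E4 0
  have h1 : ContDiff ℝ ∞ (fun y : Fin 2 → E4 => y 1) := contDiff_apply ℝ E4 1
  have hfs : ContDiff ℝ ∞ f :=
    Complex.ofRealCLM.contDiff.comp (((hgs.comp (h0.sub h1)).mul (hχs.comp h1)))
  have hθc : Continuous fun p : E4 × E4 => (![p.1 + p.2, p.2] : Fin 2 → E4) := by
    refine continuous_pi fun i => ?_
    fin_cases i
    · exact (continuous_fst.add continuous_snd).congr fun p => by simp
    · exact continuous_snd.congr fun p => by simp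
  have hfval : ∀ y : Fin 2 → E4, f y ≠ 0 → g (y 0 - y 1) ≠ 0 ∧ χ (y 1) ≠ 0 := by
    intro y hy
    constructor
    · intro h; apply hy; simp [hf, h]
    · intro h; apply hy; simp [hf, h]
  have hfc : HasCompactSupport f := by
    refine HasCompactSupport.intro ((hgc.isCompact.prod hχc.isCompact).image hθc) fun y hy => ?_
    by_contra hne'
    obtain ⟨hg', hχ'⟩ := hfval y hne'
    exact hy ⟨(y 0 - y 1, y 1), ⟨subset_tsupport _ hg', subset_tsupport _ hχ'⟩, by
      funext i; fin_cases i <;> simp⟩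
  set F : 𝓢((Fin 2 → E4), ℂ) := hfc.toSchwartzMap hfs with hFdef
  have hFf : (F : (Fin 2 → E4) → ℂ) = f := rfl
  have hT : tsupport (F : (Fin 2 → E4) → ℂ) ⊆ {y | y 0 - y 1 ∈ tsupport g ∧ y 1 ∈ tsupport χ} := by
    rw [hFf]
    refine closure_minimal (fun y hy => ?_) ?_
    · obtain ⟨hg', hχ'⟩ := hfval y hy
      exact ⟨subset_tsupport _ hg', subset_tsupport _ hχ'⟩
    · exact ((isClosed_tsupport _).preimage ((continuous_apply 0).sub (continuous_apply 1))).inter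
        ((isClosed_tsupport _).preimage (continuous_apply 1))
  -- `F` is compactly supported in `Separated 2 δ`, hence off-diagonal
  have hFc : HasCompactSupport (F : (Fin 2 → E4) → ℂ) := by rw [hFf]; exact hfc
  have hFsep : tsupport (F : (Fin 2 → E4) → ℂ) ⊆ Separated 2 δ := by
    intro y hy i j hij
    have hδ' : δ < ‖y 0 - y 1‖ := hgδ _ (hT hy).1
    fin_cases i <;> fin_cases j
    · exact absurd rfl hij
    · rw [dist_eq_norm]; exact hδ'.le
    · rw [dist_comm, dist_eq_norm]; exact hδ'.le
    · exact absurd rfl hij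
  have hFoff : IsOffDiagonal F := by
    refine IsOffDiagonal.of_tsupport_subset fun y hy hco => ?_
    obtain ⟨i, j, hij, hyij⟩ := (mem_coincidenceLocus y).1 hco
    have h : δ ≤ dist (y i) (y j) := hFsep hy i j hij
    rw [hyij, dist_self] at h
    exact absurd h (not_le.2 hδ)
  -- `S₂ F = ∫ K g` : the representation, Fubini, `∫ χ = 1`
  obtain ⟨-, hSF⟩ := hrep F hFoff hFc
  set ψ : E4 → ℝ := fun u => g u * K u with hψ
  have hψc : Continuous ψ := continuous_mul_of_tsupport_subset isOpen_ne hKc hgs.continuous hgU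
  have hψi : Integrable ψ := hψc.integrable_of_hasCompactSupport hgc.mul_right
  have hreal : (fun y : Fin 2 → E4 => (K (y 0 - y 1) : ℂ) * F y) =
      fun y => ((χ (y 1) * ψ (y 0 - y 1) : ℝ) : ℂ) := by
    funext y
    rw [show F y = f y from rfl]
    simp only [hf, hψ]
    push_cast
    ring
  have hSψ : S₂ F = ((∫ u, ψ u : ℝ) : ℂ) := by
    rw [hSF, hreal, integral_complex_ofReal, integral_fin_two_shear χ ψ hχi hψi, hχ1, one_mul]
  -- `∫ ‖F‖ = 1`
  have hnormF : ∫ y, ‖F y‖ = 1 := by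
    have h : (fun y : Fin 2 → E4 => ‖F y‖) = fun y => χ (y 1) * g (y 0 - y 1) := by
      funext y
      rw [show F y = f y from rfl]
      simp only [hf, Complex.norm_real, Real.norm_eq_abs, abs_mul, abs_of_nonneg (hg0 _), abs_of_nonneg (hχ0 _)]
      ring
    rw [h, integral_fin_two_shear χ g hχi hgi, hχ1, hg1, one_mul]
  -- `|∫ K g − K x₀| ≤ ε`
  have hclose : |(∫ u, ψ u) - K x₀| ≤ ε := by
    have hKx : ∫ u, g u * K x₀ = K x₀ := by rw [integral_mul_const, hg1, one_mul]
    have hsub : (∫ u, ψ u) - K x₀ = ∫ u, g u * (K u - K x₀) := by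
      conv_lhs => rw [← hKx]
      rw [← integral_sub hψi (hgi.mul_const _)]
      refine integral_congr_ae (Eventually.of_forall fun u => ?_)
      simp only [hψ]
      ring
    rw [hsub]
    have hbd : ∀ u, ‖g u * (K u - K x₀)‖ ≤ ε * g u := by
      intro u
      by_cases hu : u ∈ tsupport g
      · rw [norm_mul, Real.norm_eq_abs, abs_of_nonneg (hg0 u), mul_comm]
        exact mul_le_mul_of_nonneg_right (le_of_lt (by simpa [Real.dist_eq] using hgη u hu)) (hg0 u)
      · have : g u = 0 := image_eq_zero_of_notMem_tsupport hu
        simp [this]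
    calc |∫ u, g u * (K u - K x₀)| = ‖∫ u, g u * (K u - K x₀)‖ := (Real.norm_eq_abs _).symm
      _ ≤ ∫ u, ε * g u := norm_integral_le_of_norm_le (hgi.const_mul ε) (Eventually.of_forall hbd)
      _ = ε := by rw [integral_const_mul, hg1, mul_one]
  -- assemble
  have hSB : |∫ u, ψ u| ≤ B := by
    have h := hB F hFc hFsep
    rw [hSψ, Complex.norm_real, Real.norm_eq_abs, hnormF, mul_one] at h
    exact h
  calc |K x₀| = |(∫ u, ψ u) - ((∫ u, ψ u) - K x₀)| := by ring_nf
    _ ≤ |∫ u, ψ u| + |(∫ u, ψ u) - K x₀| := abs_sub _ _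
    _ ≤ B + ε := add_le_add hSB hclose

/-! ## §2 From a fixed-order lattice collar bound to the limit functional (explicit `δ`-dependence) -/

variable {G : Type} [Group G] [TopologicalSpace G] [IsTopologicalGroup G] [CompactSpace G]
  [MeasurableSpace G] [BorelSpace G]

/-- **A fixed-order centred-density collar bound passes to every sequential limit of the lattice distributions, with its explicit
`δ`-dependence.**  If for `β ≥ β₄`, every torus `4R+8 ≤ L`, every `1 ≤ R` with `R·a(β) ≤ ℓ₄` and every `N` sites at pairwise torus
sup-distance `≥ 2R+4` the centred `N`-th moment of the action densities is at most `(C/R⁴)ᴺ`, then along lattices in the ranges of an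
admissible scheme (`a_k = a(β_k) > 0`, `β_k → ∞`, `a_k → 0`, `a_k L_k → ∞`, `14 ≤ L_k`, `a_k⁻² ≤ L_k`) every limit `S₁ N` of the lattice
`N`-point distributions obeys `‖S₁ N F‖ ≤ (C (24/δ + 2/ℓ₄ + 24)⁴)ᴺ ∫‖F‖` for every `δ > 0` and every compactly supported `F` supported in
`Separated N δ` (the proof of ✓`norm_le_explicit_of_tendsto_latticeDist`, run with the order-`N` hypothesis only).
[folklore; Glimm–Jaffe 1987 §6.1] -/
theorem norm_le_of_tendsto_latticeDist_of_collar (r : LatticeRep G) {a : ℝ → ℝ} {N : ℕ}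
    {C β₄ ℓ₄ : ℝ} (hℓ : 0 < ℓ₄) (hC : 0 ≤ C)
    (H : ∀ β : ℝ, β₄ ≤ β → ∀ (L : ℕ) (x : Fin N → Site 4) (R : ℕ), 1 ≤ R → (R : ℝ) * a β ≤ ℓ₄ → 4 * R + 8 ≤ L →
      (∀ i j : Fin N, i ≠ j → ∃ k : Fin 4,
        (2 * (R : ℤ) + 4) ≤ |((((x i k - x j k : ℤ) : ZMod (2 * L + 1))).valMinAbs : ℤ)|) →
      |torusE G r β L (fun U => ∏ i, (dens G r (x i) U - torusE G r β L (dens G r (x i))))| ≤ (C / (R : ℝ) ^ 4) ^ N)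
    (as βs : ℕ → ℝ) (Ls : ℕ → ℕ) (hunits : ∀ k, as k = a (βs k)) (hβ : Tendsto βs atTop atTop)
    (hapos : ∀ k, 0 < as k) (ha0 : Tendsto as atTop (𝓝 0))
    (haL : Tendsto (fun k => as k * (Ls k : ℝ)) atTop atTop)
    (hranges : ∀ k, 14 ≤ Ls k ∧ (as k)⁻¹ * (as k)⁻¹ ≤ Ls k)
    (S₁ : SchwingerFamily E4)
    (hconv : ∀ F : 𝓢((Fin N → E4), ℂ), IsOffDiagonal F →
      Tendsto (fun k => latticeDist r.ρ (βs k) (Ls k) (as k) r.curvature.F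
        (wilsonTorusMean r.ρ (βs k) (Ls k) r.curvature.F) N F) atTop (𝓝 (S₁ N F))) :
    ∀ δ : ℝ, 0 < δ → ∀ F : 𝓢((Fin N → E4), ℂ), HasCompactSupport (F : (Fin N → E4) → ℂ) →
      tsupport (F : (Fin N → E4) → ℂ) ⊆ Separated N δ →
        ‖S₁ N F‖ ≤ (C * (24 / δ + 2 / ℓ₄ + 24) ^ 4) ^ N * ∫ x, ‖F x‖ := by
  classical
  -- adapted from ✓`F4SubCurvatureDoorSubCurvatureKernelExplicitDensity.norm_le_explicit_of_tendsto_latticeDist`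
  intro δ hδ
  set κ : ℝ := 24 / δ + 2 / ℓ₄ + 24 with hκ
  have hκ0 : 0 < κ := by positivity
  intro F hFc hFs
  -- `F` is off-diagonal: its support avoids the coincidence locus
  have hFoff : IsOffDiagonal F := by
    refine IsOffDiagonal.of_tsupport_subset fun y hy hcoin => ?_
    obtain ⟨i, j, hij, hyij⟩ := (mem_coincidenceLocus y).1 hcoin
    have h : δ ≤ dist (y i) (y j) := hFs hy i j hij
    rw [hyij, dist_self] at h
    exact absurd h (not_le.2 hδ)
  -- a support radius
  obtain ⟨ρ, hρ0, hρ⟩ : ∃ ρ : ℝ, 0 ≤ ρ ∧ tsupport (F : (Fin N → EuclideanSpace ℝ (Fin 4)) → ℂ) ⊆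
      closedBall (0 : Fin N → EuclideanSpace ℝ (Fin 4)) ρ := by
    obtain ⟨ρ, hρ⟩ := hFc.isCompact.isBounded.subset_closedBall 0
    exact ⟨max ρ 0, le_max_right _ _, hρ.trans (closedBall_subset_closedBall (le_max_left _ _))⟩
  -- the two limits: lattice distributions → `S₁ N F`, Riemann sums → `∫ ‖F‖`
  have hlim : Tendsto (fun k => ‖latticeDist r.ρ (βs k) (Ls k) (as k) r.curvature.F
      (wilsonTorusMean r.ρ (βs k) (Ls k) r.curvature.F) N F‖) atTop (𝓝 ‖S₁ N F‖) :=
    (hconv F hFoff).norm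
  have hRiem : Tendsto (fun k => as k ^ (4 * N) *
      ∑ x ∈ Fintype.piFinset (fun _ : Fin N => box 4 (Ls k)), ‖F (fun i => as k • siteToE (x i))‖)
      atTop (𝓝 (∫ y, ‖F y‖)) :=
    tendsto_riemann_sum (fun y => ‖F y‖) F.continuous.norm hFc.norm as Ls hapos ha0 haL
  -- eventual domination of the lattice distributions by the Riemann sums
  have hev : ∀ᶠ k in atTop, ‖latticeDist r.ρ (βs k) (Ls k) (as k) r.curvature.F
      (wilsonTorusMean r.ρ (βs k) (Ls k) r.curvature.F) N F‖ ≤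
      (C * κ ^ 4) ^ N * (as k ^ (4 * N) *
        ∑ x ∈ Fintype.piFinset (fun _ : Fin N => box 4 (Ls k)), ‖F (fun i => as k • siteToE (x i))‖) := by
    have hε : 0 < min (min 1 ℓ₄) (δ / 12) := lt_min (lt_min one_pos hℓ) (by positivity)
    filter_upwards [hβ.eventually_ge_atTop β₄, ha0.eventually (gt_mem_nhds hε),
      haL.eventually_ge_atTop (2 * ρ)] with k hkβ hka hkL
    have hak : 0 < as k := hapos k
    have ha1 : as k ≤ 1 := (hka.le.trans (min_le_left _ _)).trans (min_le_left _ _)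
    have haℓ : as k ≤ ℓ₄ := (hka.le.trans (min_le_left _ _)).trans (min_le_right _ _)
    have haδ : as k * 12 ≤ δ := by
      have := hka.le.trans (min_le_right _ _)
      rwa [le_div_iff₀ (by norm_num : (0 : ℝ) < 12)] at this
    obtain ⟨hL14, hLa⟩ := hranges k
    -- collar radius for the lattice separation `δ / (2 a_k) ≥ 6`
    have hδ6 : 6 ≤ δ / (2 * as k) := by
      rw [le_div_iff₀ (by positivity)]
      linarith
    obtain ⟨R, hR1, hRa, hRL, hRδ, hRinv⟩ := exists_collar_radius hδ6 hℓ hak ha1 haℓ hL14 hLa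
    have hRpos : (0 : ℝ) < R := by exact_mod_cast hR1
    have hRinv' : (R : ℝ)⁻¹ ≤ as k * κ := by
      have : 12 / (δ / (2 * as k)) + as k * (2 / ℓ₄ + 24) = as k * κ := by
        rw [hκ, div_div_eq_mul_div]
        ring
      rw [← this]
      exact hRinv
    -- the collar bound at the lattice multi-sites seen by `F`
    have hW : ∀ x : Fin N → Site 4, F (fun i => as k • siteToE (x i)) ≠ 0 →
        |torusMoment r.ρ (βs k) (Ls k) r.curvature.F
            (wilsonTorusMean r.ρ (βs k) (Ls k) r.curvature.F) x| ≤
          (C * κ ^ 4) ^ N * as k ^ (4 * N) := by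
      intro x hx
      have hy : (fun i => as k • siteToE (x i)) ∈ tsupport (F : (Fin N → EuclideanSpace ℝ (Fin 4)) → ℂ) :=
        subset_tsupport _ (Function.mem_support.2 hx)
      -- no wrap-around: all sites in the bulk of the torus
      have hwrap : ∀ i, 2 * ‖x i‖ ≤ (Ls k : ℝ) := by
        intro i
        have h1 := hρ hy
        rw [mem_closedBall, dist_zero_right] at h1
        have h2 : as k * ‖x i‖ ≤ ρ :=
          (mul_norm_le_norm_smul_siteToE hak.le (x i)).trans ((norm_le_pi_norm _ i).trans h1)
        have h3 : as k * (2 * ‖x i‖) ≤ as k * (Ls k : ℝ) := by linarith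
        exact le_of_mul_le_mul_left h3 hak
      -- lattice sup-separation `≥ δ / (2 a_k) ≥ 2R + 4`
      have hsepx : ∀ i j : Fin N, i ≠ j → 2 * (R : ℝ) + 4 ≤ ‖x i - x j‖ := by
        intro i j hij
        have h1 : δ ≤ dist (as k • siteToE (x i)) (as k • siteToE (x j)) := hFs hy i j hij
        rw [dist_eq_norm] at h1
        have h2 := norm_smul_siteToE_sub_le hak.le (x i) (x j)
        have h3 : δ / (2 * as k) ≤ ‖x i - x j‖ := by
          rw [div_le_iff₀ (by positivity)]
          linarith
        exact hRδ.trans h3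
      have hsep : ∀ i j : Fin N, i ≠ j → ∃ l : Fin 4,
          (2 * (R : ℤ) + 4) ≤ |((((x i l - x j l : ℤ) : ZMod (2 * Ls k + 1))).valMinAbs : ℤ)| := by
        intro i j hij
        obtain ⟨l, hl⟩ := exists_valMinAbs_ge_of_norm_le x hwrap i j (hsepx i j hij)
        exact ⟨l, by exact_mod_cast hl⟩
      have hRa' : (R : ℝ) * a (βs k) ≤ ℓ₄ := by
        rw [← hunits k]
        exact hRa
      have h1 := H (βs k) hkβ (Ls k) x R hR1 hRa' hRL hsep
      rw [torusE_prod_eq_torusMoment] at h1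
      have h2 : C / (R : ℝ) ^ 4 ≤ C * κ ^ 4 * as k ^ 4 := by
        have h3 : ((R : ℝ)⁻¹) ^ 4 ≤ (as k * κ) ^ 4 :=
          pow_le_pow_left₀ (inv_nonneg.2 hRpos.le) hRinv' 4
        calc C / (R : ℝ) ^ 4 = C * ((R : ℝ)⁻¹) ^ 4 := by rw [div_eq_mul_inv, inv_pow]
          _ ≤ C * (as k * κ) ^ 4 := mul_le_mul_of_nonneg_left h3 hC
          _ = C * κ ^ 4 * as k ^ 4 := by ring
      calc _ ≤ (C / (R : ℝ) ^ 4) ^ N := h1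
        _ ≤ (C * κ ^ 4 * as k ^ 4) ^ N :=
            pow_le_pow_left₀ (div_nonneg hC (pow_nonneg hRpos.le 4)) h2 N
        _ = (C * κ ^ 4) ^ N * as k ^ (4 * N) := by rw [mul_pow, pow_mul]
    -- sum over the torus
    rw [latticeDist_apply]
    refine (norm_sum_le _ _).trans ?_
    calc ∑ x ∈ Fintype.piFinset (fun _ : Fin N => box 4 (Ls k)),
          ‖((torusMoment r.ρ (βs k) (Ls k) r.curvature.F
              (wilsonTorusMean r.ρ (βs k) (Ls k) r.curvature.F) x : ℝ) : ℂ) *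
            F (fun i => as k • siteToE (x i))‖
        ≤ ∑ x ∈ Fintype.piFinset (fun _ : Fin N => box 4 (Ls k)),
          (C * κ ^ 4) ^ N * as k ^ (4 * N) * ‖F (fun i => as k • siteToE (x i))‖ := by
          refine Finset.sum_le_sum fun x _ => ?_
          rw [norm_mul, Complex.norm_real, Real.norm_eq_abs]
          by_cases hx : F (fun i => as k • siteToE (x i)) = 0
          · simp [hx]
          · exact mul_le_mul_of_nonneg_right (hW x hx) (norm_nonneg _)
      _ = (C * κ ^ 4) ^ N * (as k ^ (4 * N) *
          ∑ x ∈ Fintype.piFinset (fun _ : Fin N => box 4 (Ls k)), ‖F (fun i => as k • siteToE (x i))‖) := by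
          rw [Finset.mul_sum, Finset.mul_sum]
          exact Finset.sum_congr rfl fun x _ => by ring
  exact le_of_tendsto_of_tendsto hlim (hRiem.const_mul _) hev

/-- **The same along an admissible leg scheme**: a TWO-POINT centred-density collar bound with constants `(C, β₄, ℓ₄)` in the units `a`
gives, for every off-diagonal limit point `S₁` of every admissible leg scheme (`IsLegScheme a sch`, `OffDiagLimitAlong r sch φ S₁`,
`φ → ∞`), the two-point density bound `‖S₁ 2 F‖ ≤ (C (24/δ + 2/ℓ₄ + 24)⁴)² ∫‖F‖` for every `δ > 0` and every compactly supported `F`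
supported in `Separated 2 δ`. [folklore; Glimm–Jaffe 1987 §6.1] -/
theorem norm_two_le_of_offDiagLimitAlong_of_collar (r : LatticeRep G) {a : ℝ → ℝ}
    {C β₄ ℓ₄ : ℝ} (hℓ : 0 < ℓ₄) (hC : 0 ≤ C)
    (H : ∀ β : ℝ, β₄ ≤ β → ∀ (L : ℕ) (x : Fin 2 → Site 4) (R : ℕ), 1 ≤ R → (R : ℝ) * a β ≤ ℓ₄ → 4 * R + 8 ≤ L →
      (∀ i j : Fin 2, i ≠ j → ∃ k : Fin 4,
        (2 * (R : ℤ) + 4) ≤ |((((x i k - x j k : ℤ) : ZMod (2 * L + 1))).valMinAbs : ℤ)|) →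
      |torusE G r β L (fun U => ∏ i, (dens G r (x i) U - torusE G r β L (dens G r (x i))))| ≤ (C / (R : ℝ) ^ 4) ^ 2)
    {sch : SpeciesScheme (YMSpecies G)} (hsch : IsLegScheme a sch) {φ : ℕ → ℕ} (hφ : Tendsto φ atTop atTop)
    {S₁ : SchwingerFamily E4} (hS₁ : OffDiagLimitAlong r sch φ S₁) :
    ∀ δ : ℝ, 0 < δ → ∀ F : 𝓢((Fin 2 → E4), ℂ), HasCompactSupport (F : (Fin 2 → E4) → ℂ) →
      tsupport (F : (Fin 2 → E4) → ℂ) ⊆ Separated 2 δ →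
        ‖S₁ 2 F‖ ≤ (C * (24 / δ + 2 / ℓ₄ + 24) ^ 4) ^ 2 * ∫ x, ‖F x‖ := by
  obtain ⟨hunits, hβ, hranges⟩ := hsch
  obtain ⟨-, -, hconv⟩ := hS₁
  have hθ : Tendsto (fun k => φ k) atTop atTop := hφ
  exact norm_le_of_tendsto_latticeDist_of_collar r hℓ hC H (fun k => sch.a (φ k)) (fun k => sch.β (φ k))
    (fun k => sch.L (φ k)) (fun k => hunits _) (hβ.comp hθ) (fun k => sch.a_pos _) (sch.tendsto_a.comp hθ)
    (sch.tendsto_L.comp hθ) (fun k => ⟨(hranges _).2.2.1, (hranges _).2.2.2⟩) S₁ (hconv 2 le_rfl)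

end Summit.QuantumFields.YangMills.Theorems.F4SubCurvatureDoorSubCurvatureClauseDensityTransfer

end
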